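import Summits.BirchSwinnertonDyer.BirchSwinnertonDyer.Theorems.ThetaPartnerAtTwoSignedControlAtTwoStubPlusHondaSystemTwo
import HarnessLib

/-!
# Route `ThetaPartnerAtTwo` (TP2), crux K3 `SignedKatoDivisibilityUpToAtTwo` (stmt-BirchSwinnertonDyer-20308 / K3P′ 25631), line
# `colemanrat` v12 — HONDA⁺@2 WITH ITS LOGARITHMS EXPOSED (the plus Honda system at `2` over Mathlib's `ℚ_[2]`, every `ι`, together with
# the tower points `c_m`, the inverters `σ_m`, the display `d_n = 3•(c_{n+2} + σ_{n+2}•c_{n+2}) − 2•c_1` and `Λ(c_m) = ℓ_m`)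

Lead prover `bsd-wall-tp2-p2x` g6 (cell `bsd-wall`). HONEST FRAMING: theorems only (no definition, no named fact, no instance, no `sorry`);
closes no item; K3 / K3P′ are NOT settled and BSD is NOT proved by any of this.

## Why

The K3 endgame (memo `Cruxes/SignedKatoDivisibilityUpToAtTwo/G6-LEAD-v11.md` v4/v4.1) reads the explicit reciprocity law character by character; the
log side (R3) is kernel (`SignedKatoOffTwo.HondaLog.sum_mul_ptLogΩ_act_plusPoint_eq`: the character sums of `Λ(act τ_a D)` for
`D = 3•(c + act σ c) − 2•c₁` with `Λ(c) = ℓ_m`, `Λ(c₁) = ℓ_1`). To APPLY it to the Honda system `d` that the crux's stub quantifies over, the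
assembly needs HONDA⁺@2 with the construction DISPLAYED — the tree's `SignedEC.PlusLayer.plusHondaSystemTwo_padic` (p591589 lineage) hides `d` behind
`∃ d` and `SignedKatoOffTwo.LocalTwo.plusPointsLayer_two` displays `c, σ, d, Λ(c_m) = ℓ_m` but lacks the generation clause (GEN). This file
proves the CONJUNCTION, for the SAME `d`: `plusHondaSystemTwo_padic_withLog` — display (tower-point data of `c`, inverters `σ`, the formula for
`d`, `Λ(c_m) = ℓ_m`) ∧ (L) ∧ (TR) ∧ (GEN) ∧ (NONDIV). The proof of (GEN) is the K4 width seat's (`plusHondaSystemTwo_padic_of_ellPlus`, verbatim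
steps: `plusGen_kernel_two` for the plus point `c + σ c`, generator change `3•(c + σc) = d + 2•c_1`, odd saturation), run on the displayed `d`.

References: [Kobayashi2003] S. Kobayashi, Invent. Math. 152 (2003), Def. 1.1, §8.4 (Lemma 8.9, Props. 8.7, 8.11, 8.12); [Sprung2012] Thm. 2.2 (2′);
[KuriharaOtsuki2006] §1.3, Prop. 1.4, p. 557.
-/

set_option autoImplicit false
-- the Theorems namespace of this sub repeats the summit name by design (D-0017 nested layout)
set_option linter.dupNamespace false

noncomputable section

open scoped Classical IntermediateField Topology NNReal NumberField

namespace Summit.BirchSwinnertonDyer.BirchSwinnertonDyer.Theorems.SignedEC.PlusLayer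

open Field WeierstrassCurve NumberField IsDedekindDomain Literature.NumberTheory.EllipticCurves
  Literature.NumberTheory.GaloisRepresentations
  Literature.NumberTheory.EllipticCurves.ZpExtension Literature.NumberTheory.EllipticCurves.Kobayashi2003
  Literature.NumberTheory.EllipticCurves.FormalGroupChart Literature.NumberTheory.EllipticCurves.Rank1Residual
  Summit.BirchSwinnertonDyer.Rank1Residual.Additive Summit.BirchSwinnertonDyer.Rank1Residual.Additive.PadicCyclotomicTower
  Summit.BirchSwinnertonDyer.Rank1Residual.Additive.BallEval
  Summit.BirchSwinnertonDyer.BirchSwinnertonDyer.Theorems.SignedKatoOffTwo.LocalTwo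

/-- **HONDA⁺@2 at the model `ℚ_[2]`, every `ι`, WITH THE CONSTRUCTION DISPLAYED.** For `W/ℚ` globally minimal with `GoodSS W 2`,
`a₂(W) = 0`, the cyclotomic `κ` and every `ι : ℚ̄ → ℚ̄₂` there are tower points `c_m` (coordinates in `ℚ₂(ζ_{2^m})`, in `E₁`, with
`Λ(c_m) = ℓ_m` on the `2`-adic model, fixed by `Stab ζ_{2^m}`), inverters `σ_m` (`σ_m ζ_{2^m} = ζ_{2^m}⁻¹`) and the plus Honda system
`d_n = 3•(c_{n+2} + σ_{n+2}•c_{n+2}) − 2•c_1` satisfying (L) `d_m ∈ E(ℚ_{2,m})`, (TR) `Tr_{m+2/m+1} d_{m+2} = −d_m`, (GEN) generation of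
`E(ℚ_{2,m})` modulo `E(ℚ_{2,m−1})` and `2` by the Galois orbit of `d_m` (`m ≥ 1`), and (NONDIV) `d_0 ∉ 2·E(ℚ₂)`.
(`plusPointsLayer_two` ∧ the (GEN) argument of `plusHondaSystemTwo_padic_of_ellPlus` on the same `d`.)
[cite: Kobayashi2003, Def. 1.1, §8.4 (Lemma 8.9, Props. 8.7, 8.11, 8.12)] [cite: Sprung2012, Thm. 2.2 (2′) (p. 1487)] -/
theorem plusHondaSystemTwo_padic_withLog (W : WeierstrassCurve ℚ) [W.IsElliptic] [W.IsGloballyMinimal]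
    (hss : GoodSS W 2) (ha : W.frobeniusTrace 2 = 0) (κ : ZpExtension ℚ 2) (hκ : κ.IsCyclotomic)
    (ι : AlgebraicClosure ℚ →ₐ[ℚ] AlgebraicClosure ℚ_[2]) :
    ∃ (c : ℕ → localPoints W ℚ_[2]) (σ : ℕ → Field.absoluteGaloisGroup ℚ_[2]) (d : ℕ → localPoints W ℚ_[2]),
      (haveI := isIntegral_genFib_baseChange 2 ((integralModelInt W).map (Int.castRingHom ℤ_[2]))
        ∀ m, (toLoc ((genFibΩ_eq_baseChange ((integralModelInt W).map (Int.castRingHom ℤ_[2]))).trans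
              (baseChange_twoAdicModel W))).symm (c m) ∈
            subfieldPoints (genFibΩ 2 ((integralModelInt W).map (Int.castRingHom ℤ_[2]))) (layer 2 m).toSubfield
              coeffs_mem_layer ∧
          (toLoc ((genFibΩ_eq_baseChange ((integralModelInt W).map (Int.castRingHom ℤ_[2]))).trans
              (baseChange_twoAdicModel W))).symm (c m) ∈
            kernel (Valued.v (R := PadicAlgCl 2)) (genFibΩ 2 ((integralModelInt W).map (Int.castRingHom ℤ_[2]))) ∧
          ptLogΩ 2 ((integralModelInt W).map (Int.castRingHom ℤ_[2]))
            ((toLoc ((genFibΩ_eq_baseChange ((integralModelInt W).map (Int.castRingHom ℤ_[2]))).trans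
              (baseChange_twoAdicModel W))).symm (c m)) = ell 2 m) ∧
      (∀ m, ∀ τ ∈ stab 2 m, τ • c m = c m) ∧
      (∀ m, 1 ≤ m → σ m • zeta 2 m = (zeta 2 m)⁻¹) ∧
      (∀ n, d n = 3 • (c (n + 2) + σ (n + 2) • c (n + 2)) - 2 • c 1) ∧
      (∀ m, d m ∈ localLayerPointsOfEmb κ ι W m) ∧
      (∀ m, localTraceOfEmb κ ι W (m + 1) (m + 2) (d (m + 2)) = -d m) ∧
      (∀ m : ℕ, 1 ≤ m → ∀ P ∈ localLayerPointsOfEmb κ ι W m,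
        ∃ B ∈ AddSubgroup.closure (Set.range fun σ : absoluteGaloisGroup ℚ_[2] ↦ σ • d m),
          ∃ P' ∈ localLayerPointsOfEmb κ ι W (m - 1), ∃ R ∈ localLayerPointsOfEmb κ ι W m, P = B + P' + 2 • R) ∧
      (∀ b ∈ localLayerPointsOfEmb κ ι W 0, d 0 ≠ 2 • b) := by
  obtain ⟨c, σ, d, hcΩ, hcstab, hσ, hd, hL, hTR, hND⟩ := plusPointsLayer_two W hss ha κ hκ ι
  have hℓ : ∀ (m : ℕ) (σ : absoluteGaloisGroup ℚ_[2]), σ • zeta 2 (m + 3) = (zeta 2 (m + 3))⁻¹ →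
      ell 2 (m + 3) + σ • ell 2 (m + 3) - (zeta 2 (m + 3) + (zeta 2 (m + 3))⁻¹ - 2) ∈
        ℚ_[2]⟮zeta 2 (m + 2) + (zeta 2 (m + 2))⁻¹ - 2⟯ := fun m _ hσ' ↦ ell_add_smul_ell_sub_v_mem_adjoin_v m hσ'
  refine ⟨c, σ, d, hcΩ, hcstab, hσ, hd, hL, hTR, ?_, hND⟩
  intro m hm Q hQ
  obtain ⟨m', rfl⟩ := Nat.exists_eq_add_of_le' hm
  -- the `2`-adic model and its identification with `W ⊗ ℚ̄₂`
  set M : WeierstrassCurve ℤ_[2] := (integralModelInt W).map (Int.castRingHom ℤ_[2]) with hM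
  haveI := isElliptic_coe_twoAdicModel W
  haveI := isElliptic_toZMod_twoAdicModel W hss.1
  haveI hintΩ := isIntegral_genFib_baseChange 2 M
  set hV := (genFibΩ_eq_baseChange M).trans (baseChange_twoAdicModel W) with hVdef
  have htr : Literature.NumberTheory.EllipticCurves.HasseManin.tr (M.map PadicInt.toZMod) = 0 := by
    rw [hM, tr_twoAdicModel W hss.1, ha]
  have h₁ := a₁_twoAdicModel_mem W hss
  have htors : ∀ Q ∈ subfieldPoints (genFibΩ 2 M) (layer 2 (m' + 1 + 2)).toSubfield coeffs_mem_layer,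
      ∀ k : ℕ, 2 ^ k • Q = 0 → Q = 0 :=
    fun Q hQ k hk ↦ eq_zero_of_two_pow_smul_eq_zero_of_mem_subfieldPoints_layer M h₁ _ hQ hk
  set act : absoluteGaloisGroup ℚ_[2] → (genFibΩ 2 M).toAffine.Point → (genFibΩ 2 M).toAffine.Point :=
    fun τ P ↦ (toLoc hV).symm (τ • toLoc hV P) with hact
  -- the plus Honda point `e = c̃ + σ c̃` at level `m' + 3`
  obtain ⟨hcL, hck, hcℓ⟩ := hcΩ (m' + 3)
  set ct := (toLoc hV).symm (c (m' + 3)) with hct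
  have hσ3 := hσ (m' + 3) (by omega)
  set e := ct + act (σ (m' + 3)) ct with he
  have hacte : act (σ (m' + 3)) ct = (toLoc hV).symm (σ (m' + 3) • c (m' + 3)) := by
    rw [hact]; simp only [hct, AddEquiv.apply_symm_apply]
  have he_toLoc : toLoc hV e = c (m' + 3) + σ (m' + 3) • c (m' + 3) := by
    rw [he, map_add, hacte, hct, AddEquiv.apply_symm_apply, AddEquiv.apply_symm_apply]
  have heLayer : toLoc hV e ∈ localLayerPointsOfEmb κ ι W (m' + 1) := by
    rw [he_toLoc]
    exact add_smul_mem_localLayerPointsOfEmb_two_stab W ι hκ hσ3 (hcstab (m' + 3))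
  have heL : e ∈ subfieldPoints (genFibΩ 2 M) (ℚ_[2]⟮zeta 2 (m' + 1 + 2) + (zeta 2 (m' + 1 + 2))⁻¹ - 2⟯).toSubfield
      (PlusTower.coeffs_mem_adjoin M _) := by
    have h := (mem_localLayerPointsOfEmb_two_iff_mem_subfieldPoints_adjoin_v hV ι hκ (m' + 1) (toLoc hV e)).mp heLayer
    rwa [AddEquiv.symm_apply_apply] at h
  have hactL : act (σ (m' + 3)) ct ∈ subfieldPoints (genFibΩ 2 M) (layer 2 (m' + 3)).toSubfield coeffs_mem_layer :=
    act_mem_subfieldPoints act (act_zero hV) (act_some hV) _ hcL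
  have hactk : act (σ (m' + 3)) ct ∈ kernel (Valued.v (R := PadicAlgCl 2)) (genFibΩ 2 M) :=
    act_mem_kernel act (act_zero hV) (act_some hV) _ hck
  have hek : e ∈ kernel (Valued.v (R := PadicAlgCl 2)) (genFibΩ 2 M) :=
    (kernel (Valued.v (R := PadicAlgCl 2)) (genFibΩ 2 M)).add_mem hck hactk
  have heℓ : ptLogΩ 2 M e - (zeta 2 (m' + 1 + 2) + (zeta 2 (m' + 1 + 2))⁻¹ - 2) ∈
      ℚ_[2]⟮zeta 2 (m' + 1 + 1) + (zeta 2 (m' + 1 + 1))⁻¹ - 2⟯ := by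
    haveI := isIntegral_curveK 2 (LayerField 2 (m' + 3)) M
    rw [he, ptLogΩ_add (m := m' + 3) hcL hactL hck hactk,
      ptLogΩ_act act (act_zero hV) (act_some hV) _ (norm_zCoord_lt_one_of_mem_kernel hck), hcℓ]
    exact hℓ m' (σ (m' + 3)) hσ3
  -- `3 • Q` lies in the image of `E₁`
  have hQlayer : (toLoc hV).symm Q ∈ subfieldPoints (genFibΩ 2 M) (layer 2 (m' + 3)).toSubfield coeffs_mem_layer := by
    obtain ⟨τ₀, -, hτ₀⟩ := exists_inverter_mem_localLayerSubgroupOfEmb_two ι hκ (m' + 1)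
    exact (forall_smul_eq_iff_mem_subfieldPoints hV (m' + 3) Q).mp
      ((mem_localLayerPointsOfEmb_two_iff_stab W ι hκ hτ₀ Q).mp hQ).1
  have h3card : Nat.card (M.map PadicInt.toZMod).toAffine.Point = 3 := by
    rw [natCard_point_eq_of_tr_eq_zero M htr]
  have h3Qk : (toLoc hV).symm ((3 : ℕ) • Q) ∈ kernel (Valued.v (R := PadicAlgCl 2)) (genFibΩ 2 M) := by
    have h : Nat.card (M.map PadicInt.toZMod).toAffine.Point • (toLoc hV).symm Q ∈
        kernel (Valued.v (R := PadicAlgCl 2)) (genFibΩ 2 M) :=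
      card_smul_mem_kernel_of_mem_subfieldPoints M hQlayer
    rw [h3card, ← map_nsmul] at h
    exact @h
  have h3Qn : toLoc hV ((toLoc hV).symm ((3 : ℕ) • Q)) ∈ localLayerPointsOfEmb κ ι W (m' + 1) := by
    rw [AddEquiv.apply_symm_apply]; exact AddSubgroup.nsmul_mem _ hQ 3
  -- (GEN) for `3 • Q` with generator `c + σ c`
  obtain ⟨B, hB, P', hP', R, hR, hEq⟩ :=
    plusGen_kernel_two hV ι hκ htr (n := m' + 1) (by omega) htors heL hek heℓ h3Qk h3Qn
  rw [AddEquiv.apply_symm_apply] at hEq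
  rw [he_toLoc] at hB
  -- generator change `c + σ c ↦ d = 3 • (c + σ c) − 2 • c 1`, then odd saturation
  have hc1 : c 1 ∈ localLayerPointsOfEmb κ ι W (m' + 1 - 1) := by
    refine localLayerPointsOfEmb_mono κ ι W (Nat.zero_le _) ((mem_localLayerPointsOfEmb_zero_iff κ ι W _).mpr fun τ ↦ ?_)
    exact hcstab 1 τ (by rw [stab_two_one]; exact Subgroup.mem_top τ)
  have hedc : 3 • (c (m' + 3) + σ (m' + 3) • c (m' + 3)) = d (m' + 1) + 2 • c 1 := by
    rw [hd (m' + 1)]; abel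
  have hgen3 := plusGen_of_plusGen_generator_change (G := absoluteGaloisGroup ℚ_[2])
    (H := localLayerPointsOfEmb κ ι W (m' + 1)) (H' := localLayerPointsOfEmb κ ι W (m' + 1 - 1))
    (fun g _ hx ↦ Sprung2012.smul_mem_localLayerPointsOfEmb κ ι W _ g hx) hedc hc1 (AddSubgroup.nsmul_mem _ hQ 3)
    ⟨B, hB, P', hP', R, hR, hEq⟩
  exact plusGen_of_plusGen_odd_nsmul hQ (by decide : Odd 3) hgen3


/-! ## §2 Transport to the completion `ℚ_v` (`v ∋ 2`, `closureEmb`) with the model data exposed -/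

section AdicCompletion

open Rat.HeightOneSpectrum

/-- **HONDA⁺@2 over (`ℚ_v`, `closureEmb`) WITH THE TRANSPORT AND THE LOGARITHMS DISPLAYED.** For `W/ℚ` globally minimal with `GoodSS W 2`,
`a₂(W) = 0`, the cyclotomic `κ` and the place `v ∋ 2`: there are the model data `Φ : ℚ̄₂ ≃ₐ[ℚ] ℚ̄_v` over `φ : ℚ_[2] ≃+* ℚ_v`, an embedding
`ι : ℚ̄ → ℚ̄₂` with `closureEmb ℚ_v = Φ ∘ ι` (`SignedEC.exists_model_padic_adicCompletion`), the displayed `ℚ_[2]`-data `c, σ, d₀` of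
`plusHondaSystemTwo_padic_withLog` at `ι`, and `d = Φ_* ∘ d₀ : ℕ → E(ℚ̄_v)` satisfying the four clauses (L) (TR) (GEN) (GEN₀) of HONDA⁺@2 over
(`ℚ_v`, `closureEmb`) — the shape the crux's stub quantifies over (`∃ d, (L) ∧ (TR) ∧ (GEN) ∧ (GEN₀)`), so that an assembly may CHOOSE this `d` and
read its logarithms (`Λ(c_m) = ℓ_m`, `d₀ n = 3•(c_{n+2} + σ_{n+2}•c_{n+2}) − 2•c_1`) through the explicit `Φ_* = Affine.Point.map Φ`. Transport lemmas:
`SignedEC.modelMap_mem_localLayerPointsOfEmb_iff / modelMap_localTraceOfEmb / modelMap_surjective / map_modelMap_closure_orbit / nonDiv_modelTransport`,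
(GEN₀) at `ℚ_v` from non-divisibility: `SignedEC.plusGenZero_two_of_ne_two_nsmul` (Milne I 3.3). [cite: Kobayashi2003, Def. 1.1, §8.4 (Lemma 8.9, Props. 8.11, 8.12)]
[cite: SerreGaloisCohomology1997, II.§1.1] [cite: MilneADT2006, I Lemma 3.3] [cite: MilneFT2022, Ch. 6] -/
theorem plusHondaSystemTwo_adicCompletion_withLog (W : WeierstrassCurve ℚ) [W.IsElliptic] [W.IsGloballyMinimal]
    (hss : GoodSS W 2) (ha : W.frobeniusTrace 2 = 0) (κ : ZpExtension ℚ 2) (hκ : κ.IsCyclotomic)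
    (v : HeightOneSpectrum (𝓞 ℚ)) (hv : (2 : 𝓞 ℚ) ∈ v.asIdeal) :
    ∃ (Φ : AlgebraicClosure ℚ_[2] ≃ₐ[ℚ] AlgebraicClosure (v.adicCompletion ℚ)) (φ : ℚ_[2] ≃+* v.adicCompletion ℚ)
      (_ : ∀ y : ℚ_[2], Φ (algebraMap ℚ_[2] (AlgebraicClosure ℚ_[2]) y) =
        algebraMap (v.adicCompletion ℚ) (AlgebraicClosure (v.adicCompletion ℚ)) (φ y))
      (ι : AlgebraicClosure ℚ →ₐ[ℚ] AlgebraicClosure ℚ_[2])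
      (_ : ∀ z, closureEmb (K := ℚ) (v.adicCompletion ℚ) z = Φ (ι z))
      (c : ℕ → localPoints W ℚ_[2]) (σ : ℕ → Field.absoluteGaloisGroup ℚ_[2]) (d₀ : ℕ → localPoints W ℚ_[2])
      (d : ℕ → localPoints W (v.adicCompletion ℚ)),
      (haveI := isIntegral_genFib_baseChange 2 ((integralModelInt W).map (Int.castRingHom ℤ_[2]))
        ∀ m, (toLoc ((genFibΩ_eq_baseChange ((integralModelInt W).map (Int.castRingHom ℤ_[2]))).trans
              (baseChange_twoAdicModel W))).symm (c m) ∈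
            subfieldPoints (genFibΩ 2 ((integralModelInt W).map (Int.castRingHom ℤ_[2]))) (layer 2 m).toSubfield
              coeffs_mem_layer ∧
          (toLoc ((genFibΩ_eq_baseChange ((integralModelInt W).map (Int.castRingHom ℤ_[2]))).trans
              (baseChange_twoAdicModel W))).symm (c m) ∈
            kernel (Valued.v (R := PadicAlgCl 2)) (genFibΩ 2 ((integralModelInt W).map (Int.castRingHom ℤ_[2]))) ∧
          ptLogΩ 2 ((integralModelInt W).map (Int.castRingHom ℤ_[2]))
            ((toLoc ((genFibΩ_eq_baseChange ((integralModelInt W).map (Int.castRingHom ℤ_[2]))).trans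
              (baseChange_twoAdicModel W))).symm (c m)) = ell 2 m) ∧
      (∀ m, ∀ τ ∈ stab 2 m, τ • c m = c m) ∧
      (∀ m, 1 ≤ m → σ m • zeta 2 m = (zeta 2 m)⁻¹) ∧
      (∀ n, d₀ n = 3 • (c (n + 2) + σ (n + 2) • c (n + 2)) - 2 • c 1) ∧
      (∀ m, d₀ m ∈ localLayerPointsOfEmb κ ι W m) ∧
      (∀ m, d m = WeierstrassCurve.Affine.Point.map (W' := W)
        (Φ : AlgebraicClosure ℚ_[2] →ₐ[ℚ] AlgebraicClosure (v.adicCompletion ℚ))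
        (show (W.baseChange (AlgebraicClosure ℚ_[2])).toAffine.Point from d₀ m)) ∧
      (∀ m, d m ∈ localLayerPointsOfEmb κ (closureEmb (K := ℚ) (v.adicCompletion ℚ)) W m) ∧
      (∀ m, localTraceOfEmb κ (closureEmb (K := ℚ) (v.adicCompletion ℚ)) W (m + 1) (m + 2) (d (m + 2)) = -d m) ∧
      (∀ m : ℕ, 1 ≤ m → ∀ P ∈ localLayerPointsOfEmb κ (closureEmb (K := ℚ) (v.adicCompletion ℚ)) W m,
        ∃ B ∈ AddSubgroup.closure (Set.range fun τ : Field.absoluteGaloisGroup (v.adicCompletion ℚ) ↦ τ • d m),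
          ∃ P' ∈ localLayerPointsOfEmb κ (closureEmb (K := ℚ) (v.adicCompletion ℚ)) W (m - 1),
          ∃ R ∈ localLayerPointsOfEmb κ (closureEmb (K := ℚ) (v.adicCompletion ℚ)) W m, P = B + P' + 2 • R) ∧
      (∀ P ∈ localLayerPointsOfEmb κ (closureEmb (K := ℚ) (v.adicCompletion ℚ)) W 0,
        ∃ a : ℤ, ∃ R ∈ localLayerPointsOfEmb κ (closureEmb (K := ℚ) (v.adicCompletion ℚ)) W 0, P = a • d 0 + 2 • R) := by
  obtain ⟨Φ, φ, hf, ι, hcompat⟩ := SignedEC.exists_model_padic_adicCompletion (p := 2) (v := v) (by exact_mod_cast hv)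
  obtain ⟨c, σ, d₀, hcΩ, hcstab, hσ, hd, hL, hTR, hGEN, hND⟩ := plusHondaSystemTwo_padic_withLog W hss ha κ hκ ι
  let T : localPoints W ℚ_[2] →+ localPoints W (v.adicCompletion ℚ) :=
    WeierstrassCurve.Affine.Point.map (W' := W) (Φ : AlgebraicClosure ℚ_[2] →ₐ[ℚ] AlgebraicClosure (v.adicCompletion ℚ))
  have hT : ∀ P : localPoints W ℚ_[2], T P =
      WeierstrassCurve.Affine.Point.map (W' := W) (Φ : AlgebraicClosure ℚ_[2] →ₐ[ℚ] AlgebraicClosure (v.adicCompletion ℚ))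
        (show (W.baseChange (AlgebraicClosure ℚ_[2])).toAffine.Point from P) := fun _ ↦ rfl
  have hmem := SignedEC.modelMap_mem_localLayerPointsOfEmb_iff Φ φ hf ι (closureEmb (K := ℚ) (v.adicCompletion ℚ)) hcompat W T hT κ
  -- the transported system and its four clauses
  have hL' : ∀ m, T (d₀ m) ∈ localLayerPointsOfEmb κ (closureEmb (K := ℚ) (v.adicCompletion ℚ)) W m :=
    fun m ↦ (hmem m _).mpr (hL m)
  have hTR' : ∀ m, localTraceOfEmb κ (closureEmb (K := ℚ) (v.adicCompletion ℚ)) W (m + 1) (m + 2) (T (d₀ (m + 2))) = -T (d₀ m) := by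
    intro m
    rw [← SignedEC.modelMap_localTraceOfEmb Φ φ hf ι (closureEmb (K := ℚ) (v.adicCompletion ℚ)) hcompat W T hT κ (m + 1) (m + 2)
      (hL (m + 2)), hTR, map_neg]
  have hGEN' : ∀ m : ℕ, 1 ≤ m → ∀ P ∈ localLayerPointsOfEmb κ (closureEmb (K := ℚ) (v.adicCompletion ℚ)) W m,
      ∃ B ∈ AddSubgroup.closure (Set.range fun τ : Field.absoluteGaloisGroup (v.adicCompletion ℚ) ↦ τ • T (d₀ m)),
        ∃ P' ∈ localLayerPointsOfEmb κ (closureEmb (K := ℚ) (v.adicCompletion ℚ)) W (m - 1),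
        ∃ R ∈ localLayerPointsOfEmb κ (closureEmb (K := ℚ) (v.adicCompletion ℚ)) W m, P = B + P' + 2 • R := by
    intro m hm P' hP'
    obtain ⟨P, rfl⟩ := SignedEC.modelMap_surjective Φ W T hT P'
    obtain ⟨B, hB, P₁, hP₁, R, hR, hPe⟩ := hGEN m hm P ((hmem m P).mp hP')
    refine ⟨T B, ?_, T P₁, (hmem _ _).mpr hP₁, T R, (hmem _ _).mpr hR, by rw [hPe, map_add, map_add, map_nsmul]⟩
    rw [← SignedEC.map_modelMap_closure_orbit Φ φ hf W T hT]
    exact AddSubgroup.mem_map_of_mem T hB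
  have hND' : ∀ b ∈ localLayerPointsOfEmb κ (closureEmb (K := ℚ) (v.adicCompletion ℚ)) W 0, T (d₀ 0) ≠ 2 • b :=
    SignedEC.nonDiv_modelTransport Φ φ hf ι (closureEmb (K := ℚ) (v.adicCompletion ℚ)) hcompat W T hT κ 2 hND
  have hGEN0' := SignedEC.plusGenZero_two_of_ne_two_nsmul W hss κ v hv _ (hL' 0) hND'
  exact ⟨Φ, φ, hf, ι, hcompat, c, σ, d₀, fun m ↦ T (d₀ m), hcΩ, hcstab, hσ, hd, hL, fun _ ↦ rfl, hL', hTR', hGEN', hGEN0'⟩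

end AdicCompletion

end Summit.BirchSwinnertonDyer.BirchSwinnertonDyer.Theorems.SignedEC.PlusLayer

end
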